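import Literature.Barriers.CriticalPhenomena.LongRangeTrivialityOnZ3PerturbativeAuditProofs
import HarnessLib

/-!
# `PerturbativeTrivialityOnZ3`, second proofs file: the diagonal nearest-neighbour crossing kernel, mirror
# invariance for coordinatewise-even couplings, and the torus infrared bound of the SUM with the constant of
# its power-law part

Sibling of `LongRangeTrivialityOnZ3PerturbativeAudit.lean` (barrier catalogue D-0021, sub-problem
`Ising3DConformalLimit`, audit generation 7 of `LongRangeTrivialityOnZ3Proofs.lean`) and COMPLEMENT of
`LongRangeTrivialityOnZ3PerturbativeAuditProofs.lean`, which DISCHARGES the sharpened barrier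
(`PerturbativeTrivialityOnZ3_holds`: every `J^{(ε,α)} = 𝟙{|x-y|₁=1} + ε|x-y|₁^{-3-α}`, `ε > 0`,
`0 < α < 3/2`, has Gaussian critical smearings) by the torus route. The two files were written concurrently
(2026-08-15); this one imports the other and keeps only what is not declared there — an independent run of
the same route with a different bookkeeping of the constants, plus two structural lemmas:

1. MIRROR INVARIANCE for ANY coordinatewise-even `J_{0,·}` (`convCoupling_torusCoupling_reflect_of_sym`; the
   evenness / flip invariance of the periodisation are `torusCoupling_zero_neg` / `torusCoupling_zero_update_neg`
   of the sibling).
2. THE NEAREST-NEIGHBOUR CROSSING KERNEL VANISHES OFF THE DIAGONAL, as an explicit identity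
   (`torusCoupling_nn_crossing_eq_zero`): for `x ≠ y` in the positive half of a bond mirror, NO lift of
   `Θy - x` is a unit vector — the reflected coordinate of `Θy - x` is `-(a+b-1)` with `a = val(xᵢ-c)`,
   `b = val(yᵢ-c) ∈ [1, N/2]`, and a lift of `ℓ¹`-norm one forces `a + b ∈ {2, N}`, `a = b`, and the other
   coordinates to agree — valid for every `N ≥ 1` (no parity hypothesis); the sibling's
   `torusCoupling_nn_reflectionPositive` is the positive-semidefiniteness consequence ("reflection positivity is
   preserved under the addition of any nearest neighbor term").
3. GAUSSIAN DOMINATION FOR THE SUM with the power-law constant (`torus_twoPointFourier_le_rpow_perturbed`):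
   the hypotheses of `wInfraredBound` are additive over `J_nn^{(N)} + J_alg^{(N)}` (`torusCoupling_perturbedNN_zero`
   of the sibling) and `E_{J_nn+J_alg}(k) = E_{J_nn}(k) + E_{J_alg}(k) ≥ |J_alg|(1 - Ĵ_alg(θ_k)) ≥ |J_alg|c'‖θ_k‖^{α∧2}`
   with the cube gap bound of the power-law PART (`exists_cube_gap_lower`), so
   `Ŝ_N(k) ≤ (β|J_alg|c')⁻¹‖θ_k‖^{-(α∧2)}` off the zero mode — whereas the sibling bounds through `|J|(1 - Ĵ)` of
   the full coupling and its own cube bound `exists_cube_gap_lower_perturbedNN`.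
4. THE TORUS-TO-`ℤ³` STEP with these constants (`torus_sum_sum_box_le_perturbed`,
   `sum_sum_pairCorrelation_le_perturbed`: `∑_{x,y∈Λ_L}S_β(x-y) ≤ KL^{3+α∧2}/β` for `0 < β < β_c`, by
   Parseval + Fejér + Riemann sum, the torus zero mode below `β_c` and Griffiths' comparison), and the
   pointwise form of the discharge `not_hasNonGaussianSmearingZ3_perturbedNN` (from the sibling's
   `PerturbativeTrivialityOnZ3_holds`). The `x`-space infrared bound itself,
   `⟨σ₀σ_x⟩_{J^{(ε,α)},β} ≤ C/(β‖x‖^{3-α∧2})` for `0 < β ≤ β_c`, `x ≠ 0`, `α ≠ 2`, is the sibling's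
   `perturbedNN_infraredBound_beta` (imported; not restated here).

Revision note (2026-08-15): the first version of this file also declared the periodisation symmetries, the
nearest-neighbour reflection positivity, `hasCriticalDecay_perturbedNN` and `PerturbativeTrivialityOnZ3_holds`
under the same names as the concurrently landed sibling; those declarations are REMOVED here in favour of the
sibling's (imported), so that the two modules can be imported together. Revision note (2026-08-16): the
`x`-space assembly `pairCorrelation_perturbedNN_le` (MMS2 + the double-sum bound + left-continuity at `β_c`)
was a verbatim restatement of the sibling's `perturbedNN_infraredBound_beta` and is REMOVED (dedup-01196);
use `perturbedNN_infraredBound_beta`.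

## References

* R. Panis, arXiv:2309.05797 (2023) = Ann. Probab. 54 (2026): §3.1 (p. 13), Proposition 3.4 and
  Remark 3.5 (p. 14), §3.6 (p. 16), Theorem 5.5 and Remark 5.4 (p. 21) [Panis2023Triviality].
* M. Aizenman, R. Fernández, Lett. Math. Phys. 16 (1988), §3, p. 45 [AizenmanFernandez1988].
* S. Friedli, Y. Velenik, *Statistical Mechanics of Lattice Systems*, CUP (2017), Lemma 10.8,
  Thm. 10.24 [FriedliVelenik2017].

## Tree anchors

`torusCoupling_zero_neg`, `torusCoupling_zero_update_neg`, `torusCoupling_nn_reflectionPositive`,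
`torusCoupling_perturbedNN_zero`, `perturbedNN_zero_summable`, `perturbedNN_zero_neg`, `perturbedNN_zero_update_neg`,
`l1Norm_update_neg`, `PerturbativeTrivialityOnZ3_holds` (`…PerturbativeAuditProofs`); `torusCoupling`,
`torusCoupling_zero_left`, `torusCoupling_nonneg`, `torusLift`, `torusExpect_spinProduct_nonneg` (`…Torus`);
`torusCoupling_algebraic_reflectionPositive`, `couplingGap_torusCoupling`, `wTwoPoint_torusCoupling`,
`centeredMomentum`, `norm_centeredMomentum_pos/le`, `torusChar_zero_left`, `centeredMomentum_zero` (`…TorusRP`);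
`wInfraredBound`, `convCoupling`, `couplingGap`, `couplingGap_nonneg`, `wTwoPoint`, `Torus.reflectBetweenSites`,
`Torus.halfBetweenSites` (`WeightedInfraredBound`, `ReflectionPositivity`); `couplingNorm`, `couplingFourier`,
`couplingNorm_algebraic_pos`, `algebraicCoupling_zero_summable`, `exists_cube_gap_lower` (`…InfraredBound`);
`sum_sum_box_kernel_eq_fourier`, `norm_sum_box_cexp_zero_sq`, `norm_sum_box_cexp_sq_le`, `riemannSum_le`,
`envelope`, `sum_sum_pairCorrelation_le_of_torus` (`…InfraredBoundHolds`, `…InfraredBoundFourier`);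
`torus_zeroMode_le_eventually`, `magnetization_eq_zero_of_lt_criticalBeta` (`…TorusZeroMode`); `perturbedNN_*`
(`…PerturbativeAudit`).
-/

noncomputable section

namespace Literature.Barriers.CriticalPhenomena

open Literature.Probability.LatticeModels Literature.Probability.Percolation Filter Topology Finset
open scoped symmDiff

namespace LongRangeIsing

variable {d N : ℕ}

/-! ### Mirror invariance of the periodised coupling for coordinatewise-even `J_{0,·}` -/

/-- **Invariance of `J^{(N)}` under the reflections between sites** for coordinatewise-even
`J_{0,·}` (hypothesis `hJθ` of `wInfraredBound`). [cite: FriedliVelenik2017, Lemma 10.8] -/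
theorem convCoupling_torusCoupling_reflect_of_sym (J : Site d → Site d → ℝ)
    (hJsym : ∀ (v : Site d) (i : Fin d), J 0 (Function.update v i (-v i)) = J 0 v)
    [NeZero N] (i : Fin d) (c : ZMod N) (x y : TorusSite d N) :
    convCoupling (torusCoupling J N 0) (Torus.reflectBetweenSites i c x) (Torus.reflectBetweenSites i c y) =
      convCoupling (torusCoupling J N 0) x y := by
  unfold convCoupling
  have h : Torus.reflectBetweenSites i c y - Torus.reflectBetweenSites i c x =
      Function.update (y - x) i (-(y - x) i) := by
    funext j
    by_cases hj : j = i
    · subst hj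
      simp only [Torus.reflectBetweenSites_apply, Pi.sub_apply, Function.update_self]
      ring
    · simp [Torus.reflectBetweenSites_apply, hj]
  rw [h, torusCoupling_zero_update_neg J hJsym]

/-! ### The nearest-neighbour crossing kernel is diagonal (explicit form) -/

/-- **The nearest-neighbour crossing kernel vanishes off the diagonal**: for `x ≠ y` in the positive
half `𝕋⁺ = {1 ≤ val(xᵢ-c) ≤ N/2}` of the bond mirror `Θ = Θ_{i,c}`, no lift of `Θy - x` is a unit
vector, so `J_nn^{(N)}_{0,Θy-x} = 0`. (The reflected coordinate of `Θy - x` is `-(a+b-1)` with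
`a = val(xᵢ-c)`, `b = val(yᵢ-c) ∈ [1,N/2]`; a lift of `ℓ¹`-norm one forces `a + b ∈ {2, N}`, hence
`a = b`, and the other coordinates to agree.) [cite: AizenmanFernandez1988, §3 ("reflection positivity is preserved under the addition of any nearest neighbor term"), p. 45] -/
theorem torusCoupling_nn_crossing_eq_zero [NeZero N] (i : Fin d) (c : ZMod N) {x y : TorusSite d N}
    (hx : x ∈ Torus.halfBetweenSites i c) (hy : y ∈ Torus.halfBetweenSites i c) (hxy : x ≠ y) :
    torusCoupling (nnCoupling d) N 0 (Torus.reflectBetweenSites i c y - x) = 0 := by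
  rw [torusCoupling_zero_left]
  simp only [Torus.halfBetweenSites, Set.mem_setOf_eq] at hx hy
  obtain ⟨ha1, ha2⟩ := hx
  obtain ⟨hb1, hb2⟩ := hy
  set a : ℕ := (x i - c).val with ha
  set b : ℕ := (y i - c).val with hb
  have hN0 : 0 < N := Nat.pos_of_ne_zero (NeZero.ne N)
  have hhalf : 2 * (N / 2) ≤ N := Nat.mul_div_le N 2
  set m : ℕ := a + b - 1 with hm
  have hm1 : 1 ≤ m := by omega
  have hmN : m < N := by omega
  -- the reflected coordinate of `Θy - x` is `-(m : ZMod N)`, of value `N - m`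
  have hxi : x i - c = (a : ZMod N) := by rw [ha, ZMod.natCast_zmod_val]
  have hyi : y i - c = (b : ZMod N) := by rw [hb, ZMod.natCast_zmod_val]
  have hcoord : (Torus.reflectBetweenSites i c y - x) i = -((m : ℕ) : ZMod N) := by
    simp only [Pi.sub_apply, Torus.reflectBetweenSites_apply, Function.update_self]
    have hm' : ((m : ℕ) : ZMod N) = (a : ZMod N) + (b : ZMod N) - 1 := by
      rw [hm, Nat.cast_sub (by omega : 1 ≤ a + b), Nat.cast_add, Nat.cast_one]
    rw [hm']
    linear_combination -hxi - hyi
  have hval : ((Torus.reflectBetweenSites i c y - x) i).val = N - m := by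
    rw [hcoord, ZMod.neg_val]
    have hmval : ((m : ℕ) : ZMod N).val = m := ZMod.val_natCast_of_lt hmN
    have hmz : ((m : ℕ) : ZMod N) ≠ 0 := by
      intro h0
      rw [h0, ZMod.val_zero] at hmval
      omega
    rw [if_neg hmz, hmval]
  -- every term of the periodisation vanishes
  have hterm : ∀ z : Site d, nnCoupling d 0 (torusLift N (Torus.reflectBetweenSites i c y - x) + (N : ℤ) • z) = 0 := by
    intro z
    set v : Site d := torusLift N (Torus.reflectBetweenSites i c y - x) + (N : ℤ) • z with hv
    unfold nnCoupling
    rw [l1Norm_zero_sub]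
    split_ifs with h1
    swap; · rfl
    exfalso
    apply hxy
    -- coordinate bounds from `|v|₁ = 1`
    have hle : ∀ j, (v j).natAbs ≤ 1 := fun j => by
      rw [← h1]; exact Finset.single_le_sum (f := fun j => (v j).natAbs) (fun _ _ => Nat.zero_le _) (Finset.mem_univ j)
    have hvi : v i = ((N - m : ℕ) : ℤ) + N * z i := by
      simp only [hv, Pi.add_apply, Pi.smul_apply, smul_eq_mul, torusLift, hval]
    have hvj : ∀ j, j ≠ i → v j = (((y j - x j).val : ℕ) : ℤ) + N * z j := by
      intro j hj
      simp only [hv, Pi.add_apply, Pi.smul_apply, smul_eq_mul, torusLift, Pi.sub_apply,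
        Torus.reflectBetweenSites_apply, Function.update_of_ne hj]
    -- the reflected coordinate has `|vᵢ| = 1` and `m ∈ {1, N-1}`
    have hNm : ((N - m : ℕ) : ℤ) = (N : ℤ) - m := by push_cast [Nat.cast_sub hmN.le]; ring
    have habs_i := hle i
    have hvi_abs : |v i| ≤ 1 := by rw [Int.abs_eq_natAbs]; exact_mod_cast habs_i
    obtain ⟨hlo, hhi⟩ := abs_le.1 hvi_abs
    rw [hvi, hNm] at hlo hhi
    have hz : (z i = 0 ∧ m = N - 1) ∨ (z i = -1 ∧ m = 1) := by
      rcases lt_trichotomy (z i) (-1) with hlt | heq | hgt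
      · exfalso
        have : (N : ℤ) * z i ≤ (N : ℤ) * (-2) := mul_le_mul_of_nonneg_left (by omega) (by positivity)
        omega
      · right
        refine ⟨heq, ?_⟩
        rw [heq] at hlo
        omega
      · rcases lt_or_eq_of_le (show 0 ≤ z i by omega) with hpos | hz0
        · exfalso
          have : (N : ℤ) * 1 ≤ (N : ℤ) * z i := mul_le_mul_of_nonneg_left (by omega) (by positivity)
          omega
        · left
          refine ⟨hz0.symm, ?_⟩
          rw [← hz0] at hhi
          omega
    have hvi1 : (v i).natAbs = 1 := by
      have : v i = 1 ∨ v i = -1 := by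
        rcases hz with ⟨hz0, hmeq⟩ | ⟨hz1, hmeq⟩
        · left; rw [hvi, hNm, hz0, hmeq]; push_cast [Nat.cast_sub (by omega : 1 ≤ N)]; ring
        · right; rw [hvi, hNm, hz1, hmeq]; push_cast; ring
      rcases this with h | h <;> simp [h]
    -- hence all other coordinates of `v` vanish
    have hothers : ∀ j, j ≠ i → v j = 0 := by
      intro j hj
      have hsum : (v i).natAbs + ∑ j ∈ Finset.univ.erase i, (v j).natAbs = 1 := by
        rw [Finset.add_sum_erase Finset.univ (fun j => (v j).natAbs) (Finset.mem_univ i)]; exact h1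
      rw [hvi1] at hsum
      have h0 : ∑ j ∈ Finset.univ.erase i, (v j).natAbs = 0 := by omega
      have := Finset.sum_eq_zero_iff.1 h0 j (Finset.mem_erase.2 ⟨hj, Finset.mem_univ j⟩)
      exact Int.natAbs_eq_zero.1 this
    -- conclude `x = y`
    funext j
    by_cases hj : j = i
    · subst hj
      have hab : a = b := by
        rcases hz with ⟨-, hmeq⟩ | ⟨-, hmeq⟩ <;> omega
      have : x j - c = y j - c := by rw [hxi, hyi, hab]
      exact sub_left_inj.1 this
    · have h0 := hothers j hj
      rw [hvj j hj] at h0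
      have hval_lt : ((y j - x j).val : ℤ) < N := by exact_mod_cast ZMod.val_lt (y j - x j)
      have hval0 : 0 ≤ ((y j - x j).val : ℤ) := by positivity
      have hzj : z j = 0 := by
        rcases lt_trichotomy (z j) 0 with hlt | heq | hgt
        · exfalso
          have : (N : ℤ) * z j ≤ (N : ℤ) * (-1) := mul_le_mul_of_nonneg_left (by omega) (by positivity)
          omega
        · exact heq
        · exfalso
          have : (N : ℤ) * 1 ≤ (N : ℤ) * z j := mul_le_mul_of_nonneg_left (by omega) (by positivity)
          omega
      rw [hzj, mul_zero, add_zero] at h0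
      have hv0 : (y j - x j).val = 0 := by exact_mod_cast h0
      have : y j - x j = 0 := (ZMod.val_eq_zero _).1 hv0
      exact (sub_eq_zero.1 this).symm
  exact (tsum_congr hterm).trans tsum_zero

/-! ### The torus infrared bound of the SUM with the constant of its power-law part -/

section PerturbedTorus

variable {ε α : ℝ}

/-- Translation invariance of the nearest-neighbour coupling. [folklore] -/
theorem nnCoupling_transl (a x y : Site d) : nnCoupling d (x + a) (y + a) = nnCoupling d x y := by
  unfold nnCoupling; rw [add_sub_add_right_eq_sub]

/-- `J_nn(0,·)` is coordinatewise even. [folklore] -/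
theorem nnCoupling_zero_update_neg (v : Site d) (i : Fin d) :
    nnCoupling d 0 (Function.update v i (-v i)) = nnCoupling d 0 v :=
  nnCoupling_eq_of_l1Norm_eq (by rw [l1Norm_zero_sub, l1Norm_zero_sub, l1Norm_update_neg])

/-- `J_nn(0,·)` is even. [folklore] -/
theorem nnCoupling_zero_neg (v : Site d) : nnCoupling d 0 (-v) = nnCoupling d 0 v :=
  nnCoupling_eq_of_l1Norm_eq (by rw [sub_neg_eq_add, zero_add, l1Norm_zero_sub])

/-- **The torus infrared bound for the periodised perturbed coupling**, off the zero mode: on `𝕋_N`,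
`N` even, `N ≥ 4`, `β > 0`, with the cube gap bound `1 - Ĵ_alg(q) ≥ c'‖q‖^{α∧2}` of the power-law PART,
`Ŝ_N(k) ≤ (β|J_alg|c')⁻¹‖θ_k‖^{-(α∧2)}` for `k ≠ 0` — Gaussian domination (`wInfraredBound`) for the SUM,
whose reflection positivity is the sum of those of its two parts (`torusCoupling_nn_reflectionPositive`,
`torusCoupling_algebraic_reflectionPositive`) and whose Fourier gap dominates that of the power-law
part: `E_{J_nn+J_alg}(k) = E_{J_nn}(k) + E_{J_alg}(k) ≥ |J_alg|(1 - Ĵ_alg(θ_k))`.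
[cite: Panis2023Triviality, Proposition 3.4 and Remark 3.5, p. 14] [cite: AizenmanFernandez1988, §3, p. 45] -/
theorem torus_twoPointFourier_le_rpow_perturbed (hε : 0 < ε) (hα : 0 < α) [NeZero N] (hNe : Even N)
    (hN4 : 4 ≤ N) {β : ℝ} (hβ : 0 < β) {c' : ℝ} (hc' : 0 < c')
    (hglob : ∀ q : Fin 3 → ℝ, ‖q‖ ≤ Real.pi →
      c' * ‖q‖ ^ min α 2 ≤ 1 - couplingFourier (algebraicCoupling 3 ε α) q)
    {k : TorusSite 3 N} (hk : k ≠ 0) :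
    ∑ z, torusExpect (torusCoupling (perturbedNN ε α) N) β 0 (fun σ => spinAt 0 σ * spinAt z σ) *
        (torusChar k z).re ≤
      1 / (β * couplingNorm (algebraicCoupling 3 ε α) * c') * ‖centeredMomentum N k‖ ^ (-(min α 2)) := by
  set J := perturbedNN ε α with hJ
  set Ja := algebraicCoupling 3 ε α with hJa
  set Jn := nnCoupling 3 with hJn
  have hnn0 : ∀ a b : Site 3, 0 ≤ Jn a b := fun a b => by rw [hJn]; unfold nnCoupling; split_ifs <;> norm_num
  have hdecomp : ∀ w : TorusSite 3 N, torusCoupling J N 0 w = torusCoupling Jn N 0 w + torusCoupling Ja N 0 w :=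
    fun w => torusCoupling_perturbedNN_zero hε.le hα w
  -- the hypotheses of Gaussian domination for the sum
  have hj0 : ∀ w, 0 ≤ torusCoupling J N 0 w := fun w => torusCoupling_nonneg J N (perturbedNN_nonneg hε.le α) 0 w
  have hje : ∀ w, torusCoupling J N 0 (-w) = torusCoupling J N 0 w :=
    torusCoupling_zero_neg J (perturbedNN_zero_neg ε α)
  have hJθ : ∀ (i : Fin 3) (c : ZMod N) (x y : TorusSite 3 N),
      convCoupling (torusCoupling J N 0) (Torus.reflectBetweenSites i c x) (Torus.reflectBetweenSites i c y) =
        convCoupling (torusCoupling J N 0) x y :=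
    convCoupling_torusCoupling_reflect_of_sym J (perturbedNN_zero_update_neg ε α)
  have hK : ∀ (i : Fin 3) (c : ZMod N) (u : TorusSite 3 N → ℝ),
      0 ≤ ∑ x ∈ (Torus.halfBetweenSites i c).toFinset, ∑ y ∈ (Torus.halfBetweenSites i c).toFinset,
        convCoupling (torusCoupling J N 0) x (Torus.reflectBetweenSites i c y) * u x * u y := by
    intro i c u
    have hsplit : ∀ x y : TorusSite 3 N, convCoupling (torusCoupling J N 0) x y =
        convCoupling (torusCoupling Jn N 0) x y + convCoupling (torusCoupling Ja N 0) x y := fun x y => by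
      unfold convCoupling; exact hdecomp _
    simp_rw [hsplit, add_mul, Finset.sum_add_distrib]
    exact add_nonneg (torusCoupling_nn_reflectionPositive hNe i c u)
      (torusCoupling_algebraic_reflectionPositive (d := 3) (by norm_num) hε hα (by omega) i c u)
  -- the Fourier gap of the sum dominates that of the power-law part
  have hposA : 0 < couplingNorm Ja := couplingNorm_algebraic_pos (d := 3) (by norm_num) hε hα
  have hθ := norm_centeredMomentum_pos hk
  have hlow := hglob _ (norm_centeredMomentum_le k)
  have hD : 0 < c' * ‖centeredMomentum N k‖ ^ min α 2 := mul_pos hc' (Real.rpow_pos_of_pos hθ _)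
  have hgapA : couplingGap (torusCoupling Ja N 0) k =
      couplingNorm Ja * (1 - couplingFourier Ja (centeredMomentum N k)) :=
    couplingGap_torusCoupling Ja (fun x => algebraicCoupling_nonneg hε.le α 0 x) (algebraicCoupling_add ε α)
      (algebraicCoupling_zero_summable (d := 3) (by norm_num) hε.le hα) hposA.ne' k
  have hgap_eq : couplingGap (torusCoupling J N 0) k =
      couplingGap (torusCoupling Jn N 0) k + couplingGap (torusCoupling Ja N 0) k := by
    unfold couplingGap
    rw [← Finset.sum_add_distrib]
    refine Finset.sum_congr rfl fun w _ => ?_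
    rw [hdecomp]; ring
  have hgapN : 0 ≤ couplingGap (torusCoupling Jn N 0) k :=
    couplingGap_nonneg _ (fun w => torusCoupling_nonneg Jn N hnn0 0 w) k
  have hgap_low : couplingNorm Ja * (c' * ‖centeredMomentum N k‖ ^ min α 2) ≤ couplingGap (torusCoupling J N 0) k := by
    rw [hgap_eq, hgapA]
    have := mul_le_mul_of_nonneg_left hlow hposA.le
    linarith
  have hgapE : 0 < couplingGap (torusCoupling J N 0) k := lt_of_lt_of_le (mul_pos hposA hD) hgap_low
  -- Gaussian domination for the sum
  have h := wInfraredBound (torusCoupling J N 0) hNe hN4 hβ hj0 hje hJθ hK k hgapE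
  have hL : ∑ z, torusExpect (torusCoupling J N) β 0 (fun σ => spinAt 0 σ * spinAt z σ) * (torusChar k z).re =
      ∑ z, wTwoPoint (convCoupling (torusCoupling J N 0)) β z * (torusChar k z).re :=
    Finset.sum_congr rfl fun z _ => by rw [wTwoPoint_torusCoupling J (perturbedNN_add ε α)]
  rw [hL]
  refine h.trans ?_
  rw [Real.rpow_neg hθ.le]
  calc 1 / (β * couplingGap (torusCoupling J N 0) k)
      ≤ 1 / (β * (couplingNorm Ja * (c' * ‖centeredMomentum N k‖ ^ min α 2))) :=
        one_div_le_one_div_of_le (by positivity) (mul_le_mul_of_nonneg_left hgap_low hβ.le)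
    _ = 1 / (β * couplingNorm Ja * c') * (‖centeredMomentum N k‖ ^ min α 2)⁻¹ := by
        field_simp

end PerturbedTorus

/-! ### From the torus to `ℤ³`: the Fejér-weighted double sum below `β_c`

(The `x`-space bound `⟨σ₀σ_x⟩ ≤ C/(β‖x‖^{3-α∧2})`, `0 < β ≤ β_c`, is `perturbedNN_infraredBound_beta` of
`…PerturbativeAuditProofs`.) -/

section PerturbedXSpace

variable {ε α : ℝ}

/-- **The double sum of the torus two-point function over `Λ_L × Λ_L` for the perturbed coupling**:
zero mode plus infrared part, exactly as `torus_sum_sum_box_le` with the torus infrared bound of the SUM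
(`torus_twoPointFourier_le_rpow_perturbed`) in place of that of the pure power law.
[cite: Panis2023Triviality, proof of Proposition 3.8 (χ̃_L ≤ C₃L^d∫e^{-L²‖p‖²}Ŝ(p)dp), torus version] -/
theorem torus_sum_sum_box_le_perturbed (hε : 0 < ε) (hα : 0 < α) {c' : ℝ} (hc' : 0 < c')
    (hglob : ∀ q : Fin 3 → ℝ, ‖q‖ ≤ Real.pi →
      c' * ‖q‖ ^ min α 2 ≤ 1 - couplingFourier (algebraicCoupling 3 ε α) q)
    {N : ℕ} [NeZero N] (hNe : Even N) {L : ℕ} (hL : 1 ≤ L) (hNL : 14 * L ≤ N) {β : ℝ} (hβ : 0 < β) :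
    ∑ x ∈ box 3 L, ∑ y ∈ box 3 L, torusExpect (torusCoupling (perturbedNN ε α) N) β 0
        (fun σ => spinAt 0 σ * spinAt (Torus.proj N x - Torus.proj N y) σ) ≤
      ((N : ℝ) ^ 3)⁻¹ * (∑ z, torusExpect (torusCoupling (perturbedNN ε α) N) β 0
          (fun σ => spinAt 0 σ * spinAt z σ)) * ((((2 * L + 1 : ℕ) : ℝ) ^ 3) ^ 2) +
        (9 * Real.pi ^ 2) ^ 3 * (394 + 2 / (1 - min α 2 / 3)) ^ 3 /
          (couplingNorm (algebraicCoupling 3 ε α) * c') * (L : ℝ) ^ ((3 : ℝ) + min α 2) / β := by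
  have hd1 : 1 ≤ 3 := by norm_num
  have hN4 : 4 ≤ N := by omega
  set J := perturbedNN ε α with hJ
  set Ja := algebraicCoupling 3 ε α with hJa
  set a : ℝ := min α 2 with ha
  have ha0 : 0 < a := lt_min hα two_pos
  have had : a < (3 : ℕ) := lt_of_le_of_lt (min_le_right α 2) (by norm_num)
  have hpos : 0 < couplingNorm Ja := couplingNorm_algebraic_pos (d := 3) hd1 hε hα
  have hL0 : (0 : ℝ) < L := by exact_mod_cast hL
  set G : TorusSite 3 N → ℝ := fun z => torusExpect (torusCoupling J N) β 0 (fun σ => spinAt 0 σ * spinAt z σ) with hG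
  have hG0 : ∀ z, 0 ≤ G z := fun z => by
    simp only [hG]
    simp_rw [spinAt_mul_spinAt_eq_spinProduct]
    exact torusExpect_spinProduct_nonneg _ β 0 hβ.le le_rfl
      (torusCoupling_nonneg J N (perturbedNN_nonneg hε.le α)) _
  set θ : TorusSite 3 N → Fin 3 → ℝ := centeredMomentum N with hθ
  set B : TorusSite 3 N → ℝ := fun k => ‖∑ x ∈ box 3 L, Complex.exp (Complex.I * (phase (θ k) x : ℂ))‖ ^ 2 with hB
  set S : TorusSite 3 N → ℝ := fun k => ∑ z, G z * (torusChar k z).re with hS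
  -- Parseval
  have hpar : ∑ x ∈ box 3 L, ∑ y ∈ box 3 L, G (Torus.proj N x - Torus.proj N y) =
      ((N : ℝ) ^ 3)⁻¹ * ∑ k, S k * B k := sum_sum_box_kernel_eq_fourier G L
  -- the zero mode
  have h0 : S 0 * B 0 = (∑ z, G z) * ((((2 * L + 1 : ℕ) : ℝ) ^ 3) ^ 2) := by
    simp only [hS, hB, hθ, torusChar_zero_left, Complex.one_re, mul_one, centeredMomentum_zero]
    rw [norm_sum_box_cexp_zero_sq]
  -- the nonzero momenta
  set U : ℝ := 1 / (β * couplingNorm Ja * c') with hU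
  have hU0 : 0 ≤ U := by positivity
  have hk : ∀ k ∈ Finset.univ.erase (0 : TorusSite 3 N),
      S k * B k ≤ U * ((9 * Real.pi ^ 2) ^ 3 * (L : ℝ) ^ (2 * 3)) * (envelope 3 ((L : ℝ) • θ k) * ‖θ k‖ ^ (-a)) := by
    intro k hk
    have hk0 : k ≠ 0 := Finset.ne_of_mem_erase hk
    have hSk : S k ≤ U * ‖θ k‖ ^ (-a) := torus_twoPointFourier_le_rpow_perturbed hε hα hNe hN4 hβ hc' hglob hk0
    have hBk : B k ≤ (9 * Real.pi ^ 2) ^ 3 * (L : ℝ) ^ (2 * 3) * envelope 3 ((L : ℝ) • θ k) :=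
      norm_sum_box_cexp_sq_le hL (norm_centeredMomentum_le k)
    have hB0 : 0 ≤ B k := sq_nonneg _
    have hbound0 : 0 ≤ U * ‖θ k‖ ^ (-a) := mul_nonneg hU0 (Real.rpow_nonneg (norm_nonneg _) _)
    calc S k * B k ≤ (U * ‖θ k‖ ^ (-a)) * B k := mul_le_mul_of_nonneg_right hSk hB0
      _ ≤ (U * ‖θ k‖ ^ (-a)) * ((9 * Real.pi ^ 2) ^ 3 * (L : ℝ) ^ (2 * 3) * envelope 3 ((L : ℝ) • θ k)) :=
          mul_le_mul_of_nonneg_left hBk hbound0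
      _ = U * ((9 * Real.pi ^ 2) ^ 3 * (L : ℝ) ^ (2 * 3)) * (envelope 3 ((L : ℝ) • θ k) * ‖θ k‖ ^ (-a)) := by ring
  have hR := riemannSum_le (d := 3) hd1 ha0 had hL hNL
  -- assemble
  rw [hpar, ← Finset.add_sum_erase _ _ (Finset.mem_univ (0 : TorusSite 3 N)), mul_add, h0]
  refine add_le_add (le_of_eq (by ring)) ?_
  calc ((N : ℝ) ^ 3)⁻¹ * ∑ k ∈ Finset.univ.erase (0 : TorusSite 3 N), S k * B k
      ≤ ((N : ℝ) ^ 3)⁻¹ * ∑ k ∈ Finset.univ.erase (0 : TorusSite 3 N),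
          U * ((9 * Real.pi ^ 2) ^ 3 * (L : ℝ) ^ (2 * 3)) * (envelope 3 ((L : ℝ) • θ k) * ‖θ k‖ ^ (-a)) :=
        mul_le_mul_of_nonneg_left (Finset.sum_le_sum hk) (by positivity)
    _ = U * ((9 * Real.pi ^ 2) ^ 3 * (L : ℝ) ^ (2 * 3)) *
          (((N : ℝ) ^ 3)⁻¹ * ∑ k ∈ Finset.univ.erase (0 : TorusSite 3 N), envelope 3 ((L : ℝ) • θ k) * ‖θ k‖ ^ (-a)) := by
        rw [← Finset.mul_sum]; ring
    _ ≤ U * ((9 * Real.pi ^ 2) ^ 3 * (L : ℝ) ^ (2 * 3)) * ((394 + 2 / (1 - a / (3 : ℕ))) ^ 3 * (L : ℝ) ^ (a - (3 : ℕ))) :=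
        mul_le_mul_of_nonneg_left hR (by positivity)
    _ = (9 * Real.pi ^ 2) ^ 3 * (394 + 2 / (1 - a / 3)) ^ 3 / (couplingNorm Ja * c') * (L : ℝ) ^ ((3 : ℝ) + a) / β := by
        have e : (L : ℝ) ^ (2 * 3) * (L : ℝ) ^ (a - (3 : ℕ)) = (L : ℝ) ^ ((3 : ℝ) + a) := by
          rw [← Real.rpow_natCast, ← Real.rpow_add hL0]
          congr 1
          push_cast
          ring
        rw [hU]
        push_cast
        field_simp
        rw [← e]
        push_cast
        ring

/-- **The Fejér-weighted double sum of the free two-point function below `β_c`** for the perturbed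
coupling: `∑_{x,y∈Λ_L}S_β(x-y) ≤ KL^{3+α∧2}/β` for `0 < β < β_c`, `L ≥ 1` (the zero mode is `o(N³)`
below `β_c`, `torus_zeroMode_le_eventually`; the free state is dominated by the torus states,
`sum_sum_pairCorrelation_le_of_torus` — both coupling-generic).
[cite: Panis2023Triviality, proof of Proposition 3.8, torus version (cf. `sum_sum_pairCorrelation_le_torusRoute`)] -/
theorem sum_sum_pairCorrelation_le_perturbed (hε : 0 < ε) (hα : 0 < α) (hα2 : α ≠ 2) :
    ∃ K : ℝ, 0 < K ∧ ∀ (β : ℝ), 0 < β → β < LongRangeIsing.criticalBeta (perturbedNN ε α) →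
      ∀ (L : ℕ), 1 ≤ L →
        ∑ x ∈ box 3 L, ∑ y ∈ box 3 L, pairCorrelation (perturbedNN ε α) β 0 (x - y) ≤
          K * (L : ℝ) ^ ((3 : ℝ) + min α 2) / β := by
  have hd1 : 1 ≤ 3 := by norm_num
  set J := perturbedNN ε α with hJ
  set Ja := algebraicCoupling 3 ε α with hJa
  have hJt : ∀ a x y, J (x + a) (y + a) = J x y := perturbedNN_add ε α
  have hJnn : ∀ x y, 0 ≤ J x y := perturbedNN_nonneg hε.le α
  have hJs : Summable (J 0) := perturbedNN_zero_summable hε.le hα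
  have hpos : 0 < couplingNorm Ja := couplingNorm_algebraic_pos (d := 3) hd1 hε hα
  obtain ⟨c', hc', hglob⟩ := exists_cube_gap_lower (d := 3) hd1 hε hα hα2
  set K : ℝ := (9 * Real.pi ^ 2) ^ 3 * (394 + 2 / (1 - min α 2 / 3)) ^ 3 / (couplingNorm Ja * c') with hK
  have ha0 : 0 < min α 2 := lt_min hα two_pos
  have had : min α 2 / 3 < 1 := by
    rw [div_lt_one (by norm_num)]
    exact lt_of_le_of_lt (min_le_right α 2) (by norm_num)
  have hK0 : 0 < K := by
    have : 0 < 1 - min α 2 / 3 := by linarith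
    positivity
  refine ⟨K, hK0, fun β hβ hβc L hL => ?_⟩
  have hm : magnetization J β = 0 := magnetization_eq_zero_of_lt_criticalBeta J β hβ hβc hJnn
  have hL0 : (0 : ℝ) < L := by exact_mod_cast hL
  refine le_of_forall_pos_le_add fun δ hδ => ?_
  set V : ℝ := (((2 * L + 1 : ℕ) : ℝ) ^ 3) ^ 2 with hV
  have hV0 : 0 < V := by positivity
  obtain ⟨N₀, hN₀⟩ := torus_zeroMode_le_eventually J β hd1 hβ hJnn hJt hJs hm (show 0 < δ / V by positivity)
  refine sum_sum_pairCorrelation_le_of_torus J β hβ.le hJnn hJt hJs (N₀ := max N₀ (14 * L)) fun M _ hM hMe => ?_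
  have hM14 : 14 * L ≤ M := le_of_max_le_right hM
  have hMd : (0 : ℝ) < (M : ℝ) ^ 3 := by
    have : (0 : ℝ) < M := by exact_mod_cast (show 0 < M by omega)
    positivity
  have hzero := hN₀ M (le_of_max_le_left hM)
  have hM0 : (M : ℝ) ≠ 0 := by exact_mod_cast (show M ≠ 0 by omega)
  have hmain := torus_sum_sum_box_le_perturbed hε hα hc' hglob hMe hL hM14 hβ
  refine hmain.trans ?_
  rw [add_comm]
  refine add_le_add le_rfl ?_
  calc ((M : ℝ) ^ 3)⁻¹ * (∑ z, torusExpect (torusCoupling J M) β 0 (fun σ => spinAt 0 σ * spinAt z σ)) * V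
      ≤ ((M : ℝ) ^ 3)⁻¹ * (δ / V * (M : ℝ) ^ 3) * V :=
        mul_le_mul_of_nonneg_right (mul_le_mul_of_nonneg_left hzero (by positivity)) hV0.le
    _ = δ := by field_simp

end PerturbedXSpace

end LongRangeIsing

open LongRangeIsing

/-! ### The pointwise form of the discharge -/

/-- **Every heavy-tailed perturbation of the nearest-neighbour model is Gaussian at criticality**
(pointwise form of the discharge). [cite: Panis2023Triviality, Theorem 5.5 and Remark 5.4, p. 21] -/
theorem not_hasNonGaussianSmearingZ3_perturbedNN {ε α : ℝ} (hε : 0 < ε) (hα : 0 < α) (hα' : α < 3 / 2) :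
    ¬ HasNonGaussianSmearingZ3 (perturbedNN ε α) :=
  PerturbativeTrivialityOnZ3_holds ε α hε hα hα'

end Literature.Barriers.CriticalPhenomena

end
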